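import Summits.HubbardSuperconductivity.HubbardSuperconductivity.Theses.BcsKacWindow

/-!
# Route `BcsKacWindow`, crux `CoherenceWindowLRO` — the composition of line `birth`

Helper file for the crux item `stmt-HubbardSuperconductivity-1319` (`CoherenceWindowLRO`, rank 2 of
route `BcsKacWindow`). Line `birth` (tree: `Cruxes/CoherenceWindowLRO/Lines/birth.lean`) cuts the
crux along Yang's observable `λ_max(ρ₂(ψ)) = (twoParticleRDM ψ).supRayleigh` into
`stub_windowCondensate` (EXISTENCE of a mesoscopic condensate in the coherence window:
`c · Δ(U) · L² ≤ λ_max(ρ₂(ψ))` for every sector ground state) and `stub_dWaveCoherence`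
(its SYMMETRY: `c₂ · λ_max(ρ₂(ψ))² − C · L² ≤ Re⟨ψ, Δ_d† Δ_d ψ⟩`, window-free). This file lands
the sorry-free composition as a tree theorem:

* `birth_seam` — the real-arithmetic seam `c Δ L² ≤ λ`, `c₂ λ² − C L² ≤ P`, `C ≤ (c₂c²/2)(ΔL)²`
  `⟹ (c₂ c²/2) Δ² L⁴ ≤ P`;
* `coherenceWindowLRO_of_parts` — `stub₁-statement → stub₂-statement → CoherenceWindowLRO`
  (by name), with `c₀ := c₂c²/2`, window bottom raised to `s₁ := max s₀ √(C/c₀)` (so the `C·L²`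
  background is absorbed: this is where the crux's "`c₀` uniform in `s`" is paid for), and
  `U₁(s) := min (U₁(s) of stub 1) U₀`.

Companion: `BcsKacWindowCoherenceWindowLROYangSide.lean` (necessity: the crux forces
`(c₀/4) Δ(U)² L² ≤ λ_max(ρ₂(ψ))` in the window). Sources: C. N. Yang, Rev. Mod. Phys. **34**
(1962) 694, §4; D. J. Scalapino, Phys. Rep. **250** (1995) 329, §2. Elementary real arithmetic
otherwise; no definition and no named fact is introduced.
-/

-- the mandated namespace `Summit.<Summit>.<Problem>.Theorems` repeats `HubbardSuperconductivity`
-- (single-problem summit, D-0017), which the `dupNamespace` linter flags on every declaration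
set_option linter.dupNamespace false

namespace Summit.HubbardSuperconductivity.HubbardSuperconductivity.Theorems.BcsKacWindow

open Matrix Literature.MathematicalPhysics.QuantumLattice
open Summit.HubbardSuperconductivity.HubbardSuperconductivity.Theses.BcsKacWindow

/-- The elementary real-arithmetic seam: from `c Δ L² ≤ λ` (`c, Δ ≥ 0`),
`c₂ λ² − C L² ≤ P` and the window-bottom condition `C ≤ (c₂ c²/2) (Δ L)²` one gets
`(c₂ c² / 2) Δ² L⁴ ≤ P`. [folklore] -/
theorem birth_seam {c c₂ C Δ L lam P : ℝ} (hc : 0 ≤ c) (hc₂ : 0 ≤ c₂) (hΔ : 0 ≤ Δ)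
    (hlam : c * Δ * L ^ 2 ≤ lam) (hP : c₂ * lam ^ 2 - C * L ^ 2 ≤ P)
    (hwin : C ≤ c₂ * c ^ 2 / 2 * (Δ * L) ^ 2) :
    c₂ * c ^ 2 / 2 * Δ ^ 2 * L ^ 4 ≤ P := by
  have h0 : 0 ≤ c * Δ * L ^ 2 := by positivity
  have hsq : (c * Δ * L ^ 2) ^ 2 ≤ lam ^ 2 := pow_le_pow_left₀ h0 hlam 2
  have hsq' : c₂ * (c * Δ * L ^ 2) ^ 2 ≤ c₂ * lam ^ 2 := mul_le_mul_of_nonneg_left hsq hc₂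
  have hL2 : 0 ≤ L ^ 2 := by positivity
  have hwin' : C * L ^ 2 ≤ c₂ * c ^ 2 / 2 * (Δ * L) ^ 2 * L ^ 2 :=
    mul_le_mul_of_nonneg_right hwin hL2
  nlinarith [hsq', hwin', hP]

/-- **The composition of line `birth` (sorry-free): the two stub STATEMENTS imply the crux
`CoherenceWindowLRO` BY NAME.** Hypothesis `h₁` is verbatim the registered stub
`stub_windowCondensate` (existence of a window condensate at the condensate-number scale
`c·Δ(U)·L² ≤ λ_max(ρ₂(ψ))`), `h₂` verbatim the registered stub `stub_dWaveCoherence`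
(`B₁g` coherence of any condensate, `c₂ λ_max² − C L² ≤ Re⟨ψ, Δ_d† Δ_d ψ⟩`). If the planner promotes
the stubs to items, this is their glue. Yang, Rev. Mod. Phys. 34 (1962) 694, §4; Scalapino,
Phys. Rep. 250 (1995) 329, §2. [folklore] Witnesses: `a, b, κ₁, κ₂, Δ` from stub 1,
`c₀ := c₂c²/2`, window bottom `s₁ := max s₀ √(C/c₀)`, `U₁(s) := min (U₁(s) of stub 1) U₀`. -/
theorem coherenceWindowLRO_of_parts :
    (∃ (a b κ₁ κ₂ c s₀ : ℝ) (Δ : ℝ → ℝ), 0 < a ∧ a < b ∧ b ≤ 3 / 10 ∧ 0 < κ₁ ∧ κ₁ ≤ κ₂ ∧ 0 < c ∧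
      0 < s₀ ∧ (∀ U : ℝ, 0 < U → Real.exp (-(κ₂ / U ^ 2)) ≤ Δ U ∧ Δ U ≤ Real.exp (-(κ₁ / U ^ 2))) ∧
      ∀ s : ℝ, s₀ ≤ s → ∃ U₁ : ℝ, 0 < U₁ ∧ ∀ δ ∈ Set.Icc a b, ∀ U ∈ Set.Ioo (0 : ℝ) U₁,
        ∀ (L : ℕ) [NeZero L], Even L → s₀ ≤ Δ U * L → Δ U * L ≤ s →
          ∀ ψ : Fock (Orb (FermionTorus 2 L)), star ψ ⬝ᵥ ψ = 1 →
            IsGroundStateInSector (hubbardTorus 2 L 1 U) (2 * ⌊(1 - δ) * (L : ℝ) ^ 2 / 2⌋₊) 0 ψ →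
              c * Δ U * (L : ℝ) ^ 2 ≤ (twoParticleRDM ψ).supRayleigh) →
    (∃ c₂ C U₀ : ℝ, 0 < c₂ ∧ 0 ≤ C ∧ 0 < U₀ ∧ ∀ δ ∈ Set.Icc (0 : ℝ) (3 / 10),
      ∀ U ∈ Set.Ioo (0 : ℝ) U₀, ∀ (L : ℕ) [NeZero L], Even L →
        ∀ ψ : Fock (Orb (FermionTorus 2 L)), star ψ ⬝ᵥ ψ = 1 →
          IsGroundStateInSector (hubbardTorus 2 L 1 U) (2 * ⌊(1 - δ) * (L : ℝ) ^ 2 / 2⌋₊) 0 ψ →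
            c₂ * (twoParticleRDM ψ).supRayleigh ^ 2 - C * (L : ℝ) ^ 2 ≤
              (expect ((pairField dWaveFormFactor L)ᴴ * pairField dWaveFormFactor L) ψ).re) →
    CoherenceWindowLRO := by
  rintro ⟨a, b, κ₁, κ₂, c, s₀, Δ, ha, hab, hb, hκ₁, hκ₁₂, hc, hs₀, hpin, hwin⟩ ⟨c₂, C, U₀, hc₂, hC, hU₀, hcoh⟩
  unfold CoherenceWindowLRO
  -- the crux constants
  have hc₀ : 0 < c₂ * c ^ 2 / 2 := by positivity
  refine ⟨a, b, κ₁, κ₂, c₂ * c ^ 2 / 2, max s₀ (Real.sqrt (C / (c₂ * c ^ 2 / 2))), Δ, ha, hab,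
    by linarith, hκ₁, hκ₁₂, hc₀, lt_of_lt_of_le hs₀ (le_max_left _ _), hpin, ?_⟩
  intro s hs
  obtain ⟨U₁, hU₁, hW⟩ := hwin s ((le_max_left _ _).trans hs)
  refine ⟨min U₁ U₀, lt_min hU₁ hU₀, ?_⟩
  intro δ hδ U hU L _ hE hlo hhi ψ hψ hgs
  have hUpos : 0 < U := hU.1
  have hU₁' : U ∈ Set.Ioo (0 : ℝ) U₁ := ⟨hU.1, lt_of_lt_of_le hU.2 (min_le_left _ _)⟩
  have hU₀' : U ∈ Set.Ioo (0 : ℝ) U₀ := ⟨hU.1, lt_of_lt_of_le hU.2 (min_le_right _ _)⟩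
  have hδ' : δ ∈ Set.Icc (0 : ℝ) (3 / 10) := ⟨by linarith [hδ.1], by linarith [hδ.2]⟩
  have hs₀L : s₀ ≤ Δ U * L := (le_max_left _ _).trans hlo
  -- the two stubs at this ground state
  have hlam := hW δ hδ U hU₁' L hE hs₀L hhi ψ hψ hgs
  have hP := hcoh δ hδ' U hU₀' L hE ψ hψ hgs
  -- positivity of the scales
  have hΔpos : 0 < Δ U := lt_of_lt_of_le (Real.exp_pos _) (hpin U hUpos).1
  have hLpos : (0 : ℝ) < (L : ℝ) := Nat.cast_pos.mpr (Nat.pos_of_ne_zero (NeZero.ne L))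
  -- the window-bottom condition: C ≤ c₀ (Δ L)²
  have hsqrt : Real.sqrt (C / (c₂ * c ^ 2 / 2)) ≤ Δ U * L := (le_max_right _ _).trans hlo
  have hwin' : C ≤ c₂ * c ^ 2 / 2 * (Δ U * L) ^ 2 := by
    have h1 : C / (c₂ * c ^ 2 / 2) ≤ (Δ U * L) ^ 2 := by
      have h2 : Real.sqrt (C / (c₂ * c ^ 2 / 2)) ^ 2 ≤ (Δ U * L) ^ 2 :=
        pow_le_pow_left₀ (Real.sqrt_nonneg _) hsqrt 2
      rwa [Real.sq_sqrt (div_nonneg hC hc₀.le)] at h2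
    rwa [div_le_iff₀' hc₀] at h1
  have key := birth_seam hc.le hc₂.le hΔpos.le hlam hP hwin'
  rw [le_div_iff₀ (by positivity)]
  linarith [key]

end Summit.HubbardSuperconductivity.HubbardSuperconductivity.Theorems.BcsKacWindow
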